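import Literature.Probability.Process.ItoIntegralConstruction
import Literature.Probability.Process.SimpleProcessAlgebra
import HarnessLib

/-!
# Route `ColdStartUniversality` (rung input (M), crux K_A1 stmt-QuantumFields-24809): dyadic Riemann–Itô sums RESTART
# at a dyadic time — the elementary integrals of the dyadic samples after a grid point are the elementary integrals of
# the samples of the restarted integrand against the restarted integrator

Helper file (seat `ym-line-csu-p1`, g4); the combinatorial identity behind the splicing proof of the flow (cocycle)
property.  For a dyadic time `s = k₀/2^{m₀}`, a level `m ≥ m₀`, an integrand/integrator pair `(σ, B)` read at `ω` and a
pair `(σ', B')` read at `ω'` with `σ'_v(ω') = σ_{s+v}(ω)` and `B'_v(ω') = B_{s+v}(ω) − B_s(ω)`: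

  `(sample σ m · B)_{s+r}(ω) − (sample σ m · B)_s(ω) = (sample σ' m · B')_r(ω')`   for `s + r ≤ m`

(`SimpleProcess.sample` = dyadic sampling of the tree's `ItoIntegralConstruction`; the grid of level `m` contains `s`
and is invariant under the shift by `s`).  Pure bookkeeping on finite sums; no probability.  No definition, no sorry.
RECORD-rung R3 plumbing; nothing here bears on the mass gap.
-/

set_option autoImplicit false

noncomputable section

namespace Summit.QuantumFields.YangMills.Theorems.ColdStartUniversality

open MeasureTheory Filter Topology Finset
open scoped NNReal BigOperators
open Literature Literature.Probability.Process

/-- **Restart identity for dyadic Riemann–Itô sums.** [folklore] -/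
theorem sample_integral_shift {Ω Ω' : Type*} {mΩ : MeasurableSpace Ω} {mΩ' : MeasurableSpace Ω'}
    {𝓕 : Filtration ℝ≥0 mΩ} {𝓕' : Filtration ℝ≥0 mΩ'}
    {σ : ℝ≥0 → Ω → ℝ} (hσ : Adapted 𝓕 σ) {σ' : ℝ≥0 → Ω' → ℝ} (hσ' : Adapted 𝓕' σ')
    (B : ℝ≥0 → Ω → ℝ) (B' : ℝ≥0 → Ω' → ℝ) (ω : Ω) (ω' : Ω') (k₀ m₀ : ℕ)
    (hσσ' : ∀ v, σ' v ω' = σ ((k₀ : ℝ≥0) / 2 ^ m₀ + v) ω)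
    (hBB' : ∀ v, B' v ω' = B ((k₀ : ℝ≥0) / 2 ^ m₀ + v) ω - B ((k₀ : ℝ≥0) / 2 ^ m₀) ω)
    {m : ℕ} (hm : m₀ ≤ m) {r : ℝ≥0} (hr : (k₀ : ℝ≥0) / 2 ^ m₀ + r ≤ m) :
    (SimpleProcess.sample σ hσ m).integral B ((k₀ : ℝ≥0) / 2 ^ m₀ + r) ω -
        (SimpleProcess.sample σ hσ m).integral B ((k₀ : ℝ≥0) / 2 ^ m₀) ω =
      (SimpleProcess.sample σ' hσ' m).integral B' r ω' := by
  set s : ℝ≥0 := (k₀ : ℝ≥0) / 2 ^ m₀ with hs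
  set K : ℕ := k₀ * 2 ^ (m - m₀) with hKdef
  set N : ℕ := m * 2 ^ m with hNdef
  have h2m : (0 : ℝ≥0) < 2 ^ m := pow_pos two_pos m
  have h2m0 : (0 : ℝ≥0) < 2 ^ m₀ := pow_pos two_pos m₀
  -- `K / 2^m = s`
  have hpow : (2 : ℝ≥0) ^ m = 2 ^ m₀ * 2 ^ (m - m₀) := by
    rw [← pow_add, Nat.add_sub_cancel' hm]
  have hK : ((K : ℕ) : ℝ≥0) / 2 ^ m = s := by
    rw [hKdef, hs, Nat.cast_mul, Nat.cast_pow, Nat.cast_ofNat, hpow,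
      mul_div_mul_right _ _ (pow_ne_zero _ two_ne_zero)]
  -- grid points
  have hgrid : ∀ k : ℕ, (((K + k : ℕ) : ℝ≥0) / 2 ^ m) = s + (k : ℝ≥0) / 2 ^ m := by
    intro k
    rw [Nat.cast_add, add_div, hK]
  -- `K ≤ N`
  have hsm : s ≤ m := le_trans le_self_add hr
  have hKN : K ≤ N := by
    have h1 : ((K : ℕ) : ℝ≥0) ≤ (N : ℕ) := by
      -- `K = s * 2^m ≤ m * 2^m = N`
      have h2 : ((K : ℕ) : ℝ≥0) = s * 2 ^ m := by
        rw [← hK, div_mul_cancel₀ _ (pow_ne_zero _ two_ne_zero)]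
      rw [h2, hNdef, Nat.cast_mul, Nat.cast_pow, Nat.cast_ofNat]
      exact mul_le_mul_of_nonneg_right hsm (le_of_lt h2m)
    exact_mod_cast h1
  -- partition times of both samples
  have ht : ∀ k, k ≤ N → (SimpleProcess.sample σ hσ m).time k = (k : ℝ≥0) / 2 ^ m := fun k hk =>
    SimpleProcess.sample_time σ hσ m (by rw [hNdef] at hk; omega)
  have ht' : ∀ k, k ≤ N → (SimpleProcess.sample σ' hσ' m).time k = (k : ℝ≥0) / 2 ^ m := fun k hk =>
    SimpleProcess.sample_time σ' hσ' m (by rw [hNdef] at hk; omega)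
  have hlen : (SimpleProcess.sample σ hσ m).times.length - 1 = N := by
    rw [SimpleProcess.sample_times, length_dyadicTimes]; rfl
  have hlen' : (SimpleProcess.sample σ' hσ' m).times.length - 1 = N := by
    rw [SimpleProcess.sample_times, length_dyadicTimes]; rfl
  -- values
  have hval : ∀ k : ℕ, (SimpleProcess.sample σ hσ m).value (K + k) ω =
      (SimpleProcess.sample σ' hσ' m).value k ω' := by
    intro k
    rw [SimpleProcess.sample_value, SimpleProcess.sample_value, hσσ', ← hgrid k]
  -- the integrator after `s`
  have hB' : ∀ a : ℝ≥0, B (min (s + r) (s + a)) ω = B' (min r a) ω' + B s ω := by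
    intro a
    rw [min_add_add_left, hBB', sub_add_cancel]
  -- unfold the three elementary integrals
  rw [SimpleProcess.integral_apply_eq_sum_summand, SimpleProcess.integral_apply_eq_sum_summand,
    SimpleProcess.integral_apply_eq_sum_summand, hlen, hlen', ← Finset.sum_sub_distrib]
  simp only [SimpleProcess.summand_apply]
  -- split the sum on the left at `K`, the sum on the right at `N - K`
  have hNsplit : N = K + (N - K) := (Nat.add_sub_cancel' hKN).symm
  have hNsplit' : N = (N - K) + K := by omega
  conv_lhs => rw [hNsplit, Finset.sum_range_add]
  conv_rhs => rw [hNsplit', Finset.sum_range_add]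
  -- (1) before `s` the two increments coincide
  have h1 : ∑ k ∈ range K, ((SimpleProcess.sample σ hσ m).value k ω *
      (B (min (s + r) ((SimpleProcess.sample σ hσ m).time (k + 1))) ω -
        B (min (s + r) ((SimpleProcess.sample σ hσ m).time k)) ω) -
      (SimpleProcess.sample σ hσ m).value k ω *
      (B (min s ((SimpleProcess.sample σ hσ m).time (k + 1))) ω -
        B (min s ((SimpleProcess.sample σ hσ m).time k)) ω)) = 0 := by
    refine Finset.sum_eq_zero fun k hk => ?_
    have hkK : k < K := mem_range.1 hk
    have hk1 : ((k + 1 : ℕ) : ℝ≥0) / 2 ^ m ≤ s := by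
      rw [← hK]
      exact div_le_div_of_nonneg_right (by exact_mod_cast hkK) h2m.le
    have hk0 : ((k : ℕ) : ℝ≥0) / 2 ^ m ≤ s :=
      le_trans (div_le_div_of_nonneg_right (by exact_mod_cast (Nat.le_succ k)) h2m.le) hk1
    rw [ht (k + 1) (by omega), ht k (by omega), min_eq_right (hk1.trans le_self_add), min_eq_right hk1,
      min_eq_right (hk0.trans le_self_add), min_eq_right hk0, sub_self]
  -- (2) after `s`: the increments at time `s` vanish, those at `s + r` are the restarted ones
  have h2 : ∀ k ∈ range (N - K), ((SimpleProcess.sample σ hσ m).value (K + k) ω *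
      (B (min (s + r) ((SimpleProcess.sample σ hσ m).time (K + k + 1))) ω -
        B (min (s + r) ((SimpleProcess.sample σ hσ m).time (K + k))) ω) -
      (SimpleProcess.sample σ hσ m).value (K + k) ω *
      (B (min s ((SimpleProcess.sample σ hσ m).time (K + k + 1))) ω -
        B (min s ((SimpleProcess.sample σ hσ m).time (K + k))) ω)) =
      (SimpleProcess.sample σ' hσ' m).value k ω' *
        (B' (min r ((SimpleProcess.sample σ' hσ' m).time (k + 1))) ω' -
          B' (min r ((SimpleProcess.sample σ' hσ' m).time k)) ω') := by
    intro k hk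
    have hkN : k < N - K := mem_range.1 hk
    rw [ht (K + k + 1) (by omega), ht (K + k) (by omega), ht' (k + 1) (by omega), ht' k (by omega),
      show K + k + 1 = K + (k + 1) from rfl, hgrid (k + 1), hgrid k, hval k, hB', hB',
      min_eq_left (le_self_add : s ≤ s + ((k + 1 : ℕ) : ℝ≥0) / 2 ^ m),
      min_eq_left (le_self_add : s ≤ s + ((k : ℕ) : ℝ≥0) / 2 ^ m), sub_self, mul_zero, sub_zero]
    ring
  -- (3) the restarted sum beyond `m - s` vanishes
  have h3 : ∑ k ∈ range K, (SimpleProcess.sample σ' hσ' m).value (N - K + k) ω' *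
      (B' (min r ((SimpleProcess.sample σ' hσ' m).time (N - K + k + 1))) ω' -
        B' (min r ((SimpleProcess.sample σ' hσ' m).time (N - K + k))) ω') = 0 := by
    refine Finset.sum_eq_zero fun k hk => ?_
    have hkK : k < K := mem_range.1 hk
    have hrle : ∀ j : ℕ, N - K ≤ j → r ≤ ((j : ℕ) : ℝ≥0) / 2 ^ m := by
      intro j hj
      rw [le_div_iff₀ h2m]
      have h1 : s * 2 ^ m + r * 2 ^ m ≤ (N : ℕ) := by
        have := mul_le_mul_of_nonneg_right hr h2m.le
        rw [add_mul] at this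
        simpa [hNdef] using this
      have h2 : s * 2 ^ m = (K : ℕ) := by rw [← hK, div_mul_cancel₀ _ (pow_ne_zero _ two_ne_zero)]
      have h3 : ((N : ℕ) : ℝ≥0) - (K : ℕ) ≤ (j : ℕ) := by
        rw [← Nat.cast_tsub]; exact_mod_cast hj
      rw [h2] at h1
      calc r * 2 ^ m ≤ (N : ℕ) - (K : ℕ) := le_tsub_of_add_le_left h1
        _ ≤ _ := h3
    rw [ht' (N - K + k + 1) (by omega), ht' (N - K + k) (by omega),
      min_eq_left (hrle (N - K + k + 1) (by omega)), min_eq_left (hrle (N - K + k) (by omega)), sub_self, mul_zero]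
  rw [h1, zero_add, h3, add_zero]
  exact Finset.sum_congr rfl h2

end Summit.QuantumFields.YangMills.Theorems.ColdStartUniversality

end
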